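import Mathlib
import Literature.NumberTheory.LFunctions.WeilExplicit
import Literature.NumberTheory.LFunctions.WeilSemilocalCompactnessProofs
import Literature.NumberTheory.LFunctions.WeilArchimedeanMoments
import HarnessLib

/-!
# The odd Fourier envelope on the critical line

Stub `stub_oddFourierEnvelope` (ENV) for the line *parity–multiplicity–commutator* of the crux
`GroundStateSimpleEven` (Weil ground state).

For an ODD test function `g` with `tsupport g ⊆ [-a, a]` the cosine part of
`ĝ(1/2 + it) = ∫ g(x) e^{itx} dx` vanishes (substitute `x ↦ -x`), so
`ĝ(1/2 + it) = (∫ g(x) sin(tx) dx) · i`, and Cauchy–Schwarz on `[-a, a]` (in the elementary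
discriminant form `0 ≤ ∫_{[-a,a]} (c‖g‖ - |sin(t·)|)²` for every real `c`) gives

  `‖ĝ(1/2 + it)‖² ≤ (∫_{-a}^{a} sin²(tx) dx) · ‖g‖₂² = (a − sin(2at)/(2t)) · ‖g‖₂²`

(`t ≠ 0`; at `t = 0` the left side is `0` and the right side is `a ‖g‖₂²`, Lean's `x / 0 = 0`).
-/

noncomputable section

open Set MeasureTheory Filter Complex
open scoped Real Topology ComplexConjugate
open Literature.NumberTheory.LFunctions

namespace Summit.RiemannHypothesis.RiemannHypothesis.Theorems

namespace GroundStateSimpleEven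

variable {g : ℝ → ℂ}

set_option linter.dupNamespace false in
/-- `∫_{-a}^{a} sin²(tx) dx = a − sin(2at)/(2t)` for `t ≠ 0`. [folklore] -/
theorem env_integral_sin_sq {t : ℝ} (ht : t ≠ 0) (a : ℝ) :
    ∫ x in (-a)..a, Real.sin (t * x) ^ 2 = a - Real.sin (2 * a * t) / (2 * t) := by
  have h := intervalIntegral.integral_comp_mul_left (f := fun y : ℝ ↦ Real.sin y ^ 2)
    (a := -a) (b := a) ht
  rw [h, integral_sin_sq, smul_eq_mul, show 2 * a * t = 2 * (t * a) by ring, Real.sin_two_mul,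
    mul_neg, Real.sin_neg, Real.cos_neg]
  field_simp
  ring

set_option linter.dupNamespace false in
/-- For odd `g`: `∫ g(x) cos(tx) dx = 0` (substitute `x ↦ -x`). [folklore] -/
theorem env_integral_mul_cos_eq_zero (hodd : ∀ x, g (-x) = -g x) (t : ℝ) :
    ∫ x : ℝ, g x * (Real.cos (t * x) : ℂ) = 0 := by
  have h := integral_neg_eq_self (fun x : ℝ ↦ g x * (Real.cos (t * x) : ℂ)) volume
  simp only [hodd, mul_neg, Real.cos_neg, neg_mul, integral_neg] at h
  linear_combination (-(1 : ℂ) / 2) * h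

set_option linter.dupNamespace false in
/-- For an odd test function `g`: `ĝ(1/2 + it) = (∫ g(x) sin(tx) dx) · i`. [folklore] -/
theorem env_weilMellin_half_line_odd (hg : IsWeilTest g) (hodd : ∀ x, g (-x) = -g x) (t : ℝ) :
    weilMellin g (1 / 2 + t * I) = (∫ x : ℝ, g x * (Real.sin (t * x) : ℂ)) * I := by
  rw [weilMellin_half_line_eq]
  have e : (fun x : ℝ ↦ g x * cexp (t * I * x)) =
      fun x : ℝ ↦ g x * (Real.cos (t * x) : ℂ) + g x * (Real.sin (t * x) : ℂ) * I := by
    funext x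
    have hx : (t : ℂ) * I * x = ((t * x : ℝ) : ℂ) * I := by push_cast; ring
    rw [hx, Complex.exp_ofReal_mul_I]
    ring
  rw [e, integral_add (hg.integrable_mul (by fun_prop))
    ((hg.integrable_mul (by fun_prop)).mul_const I), env_integral_mul_cos_eq_zero hodd t, zero_add,
    integral_mul_const]

set_option linter.dupNamespace false in
/-- Cauchy–Schwarz on `[-a, a]` for a test function supported there and a continuous real weight,
in the elementary discriminant form (`0 ≤ ∫_{[-a,a]} (c‖g‖ − |s|)²` for all real `c`):
`(∫ ‖g‖ |s|)² ≤ (∫_{[-a,a]} s²) · ‖g‖₂²`. [folklore] -/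
theorem env_cauchySchwarz (hg : IsWeilTest g) {a : ℝ} (hsupp : tsupport g ⊆ Icc (-a) a)
    {s : ℝ → ℝ} (hs : Continuous s) :
    (∫ x, ‖g x‖ * |s x|) ^ 2 ≤ (∫ x in Icc (-a) a, s x ^ 2) * ∫ x, ‖g x‖ ^ 2 := by
  set N := ∫ x, ‖g x‖ ^ 2 with hN
  set M := ∫ x, ‖g x‖ * |s x| with hM
  set S := ∫ x in Icc (-a) a, s x ^ 2 with hS
  have hgn : Continuous fun x ↦ ‖g x‖ := hg.1.continuous.norm
  have hIcc : IsCompact (Icc (-a) a) := isCompact_Icc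
  have i1 : ∫ x in Icc (-a) a, ‖g x‖ * |s x| = M :=
    setIntegral_eq_integral_of_forall_compl_eq_zero fun x hx ↦ by
      simp [eq_zero_of_tsupport_subset hsupp hx]
  have i2 : ∫ x in Icc (-a) a, ‖g x‖ ^ 2 = N :=
    setIntegral_eq_integral_of_forall_compl_eq_zero fun x hx ↦ by
      simp [eq_zero_of_tsupport_subset hsupp hx]
  have hint1 : IntegrableOn (fun x ↦ ‖g x‖ * |s x|) (Icc (-a) a) :=
    (hgn.mul hs.abs).continuousOn.integrableOn_compact hIcc
  have hint2 : IntegrableOn (fun x ↦ ‖g x‖ ^ 2) (Icc (-a) a) :=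
    (hgn.pow 2).continuousOn.integrableOn_compact hIcc
  have hint3 : IntegrableOn (fun x ↦ s x ^ 2) (Icc (-a) a) :=
    (hs.pow 2).continuousOn.integrableOn_compact hIcc
  have hquad : ∀ c : ℝ, 0 ≤ N * (c * c) + -(2 * M) * c + S := by
    intro c
    have key : 0 ≤ ∫ x in Icc (-a) a, (c * ‖g x‖ - |s x|) ^ 2 :=
      setIntegral_nonneg measurableSet_Icc fun x _ ↦ sq_nonneg _
    have expand : ∫ x in Icc (-a) a, (c * ‖g x‖ - |s x|) ^ 2 =
        c * c * (∫ x in Icc (-a) a, ‖g x‖ ^ 2) - 2 * c * (∫ x in Icc (-a) a, ‖g x‖ * |s x|) +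
          ∫ x in Icc (-a) a, s x ^ 2 := by
      have e : (fun x ↦ (c * ‖g x‖ - |s x|) ^ 2) =
          fun x ↦ c * c * ‖g x‖ ^ 2 - 2 * c * (‖g x‖ * |s x|) + s x ^ 2 := by
        funext x; rw [sub_sq, mul_pow, sq_abs]; ring
      have hA : Integrable (fun x ↦ c * c * ‖g x‖ ^ 2 - 2 * c * (‖g x‖ * |s x|))
          (volume.restrict (Icc (-a) a)) := (hint2.const_mul _).sub (hint1.const_mul _)
      rw [e, integral_add hA hint3, integral_sub (hint2.const_mul _) (hint1.const_mul _),
        integral_const_mul, integral_const_mul]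
    rw [expand, i1, i2] at key
    linarith
  have hd := discrim_le_zero hquad
  rw [discrim] at hd
  linarith

end GroundStateSimpleEven

set_option linter.dupNamespace false in
/-- **The odd Fourier envelope (ENV).** For an ODD test function `g` on `[-a, a]`,
`ĝ(1/2 + it) = i ∫ g(x) sin(tx) dx`, so by Cauchy–Schwarz on `[-a, a]`
`|ĝ(1/2 + it)|² ≤ ‖g‖₂² ∫_{-a}^{a} sin²(tx) dx = ‖g‖₂² (a − sin(2at)/(2t))` (at `t = 0` both sides
read `0 ≤ a‖g‖₂²`, Lean's `x/0 = 0`). [folklore] -/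
theorem stub_oddFourierEnvelope :
    ∀ a : ℝ, 0 < a → ∀ g : ℝ → ℂ, IsWeilTest g → tsupport g ⊆ Icc (-a) a →
      (∀ x, g (-x) = -g x) → ∀ t : ℝ,
        ‖weilMellin g (1 / 2 + t * Complex.I)‖ ^ 2 ≤
          (a - Real.sin (2 * a * t) / (2 * t)) * ∫ x, ‖g x‖ ^ 2 := by
  intro a ha g hg hsupp hodd t
  rw [GroundStateSimpleEven.env_weilMellin_half_line_odd hg hodd t, norm_mul, Complex.norm_I,
    mul_one]
  have hN : 0 ≤ ∫ x, ‖g x‖ ^ 2 := integral_nonneg fun _ ↦ by positivity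
  have h1 : ‖∫ x : ℝ, g x * (Real.sin (t * x) : ℂ)‖ ≤ ∫ x, ‖g x‖ * |Real.sin (t * x)| := by
    refine (norm_integral_le_integral_norm _).trans_eq ?_
    congr 1
    funext x
    rw [norm_mul, Complex.norm_real, Real.norm_eq_abs]
  have h2 := GroundStateSimpleEven.env_cauchySchwarz hg hsupp (s := fun x ↦ Real.sin (t * x))
    (by fun_prop)
  have h3 : ∫ x in Icc (-a) a, Real.sin (t * x) ^ 2 ≤ a - Real.sin (2 * a * t) / (2 * t) := by
    rcases eq_or_ne t 0 with rfl | ht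
    · simpa using ha.le
    · rw [integral_Icc_eq_integral_Ioc, ← intervalIntegral.integral_of_le (by linarith),
        GroundStateSimpleEven.env_integral_sin_sq ht a]
  calc ‖∫ x : ℝ, g x * (Real.sin (t * x) : ℂ)‖ ^ 2
      ≤ (∫ x, ‖g x‖ * |Real.sin (t * x)|) ^ 2 := pow_le_pow_left₀ (norm_nonneg _) h1 2
    _ ≤ (∫ x in Icc (-a) a, Real.sin (t * x) ^ 2) * ∫ x, ‖g x‖ ^ 2 := h2
    _ ≤ (a - Real.sin (2 * a * t) / (2 * t)) * ∫ x, ‖g x‖ ^ 2 :=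
        mul_le_mul_of_nonneg_right h3 hN

end Summit.RiemannHypothesis.RiemannHypothesis.Theorems
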